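import Summits.QuantumFields.BalabanUV.T4Continuum.Support.CTConjugationPieces
import Summits.QuantumFields.BalabanUV.T4Continuum.Support.ScalarCovariantCTDefects
import Summits.QuantumFields.BalabanUV.T4Continuum.Support.ScalarAveragedCompression

/-!
# T⁴ programme, SUBSTRATE (shared lattice-gauge analysis library) — LEVEL-FREE CONJUGATION BOUNDS OF THE LOCAL RECTANGULAR PIECES ON THE FINE
# TORUS: the gradient `∂` (and `∂ᴴ`), the isometric block averaging `Q̃′ = √(n^d)·Q′` (and `Q̃′ᴴ`), the block-mean projector `Π′`
# (programme VEC, file 2b; instances of `CTConjugationPieces.opNorm_conjMat_sub_le_schur`)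

Substrate cell `b2b-balaban-substrate-*`, seat p3.  With a `1/n`-Lipschitz site weight `ρ₀` of block oscillation `≤ Λ` on `Tor (fine n M)` and the
induced bond ∕ coarse weights (`bondW₀ ρ₀ (x,ν) = ρ₀ x`, `coarseW ρ₀ y = ρ₀(n·y)` at the block corner):
 * **`opNorm_conjMat_GradOp_sub_le`** `‖c∂ − ∂‖ ≤ 2√d·|κ|·e^{|κ|}` (entries `n` at weight-distance `≤ 1/n`, `n(e^{|κ|/n} − 1) ≤ |κ|e^{|κ|}`),
   **`opNorm_conjMat_GradOpH_sub_le`** (adjoint rule);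
 * **`opNorm_conjMat_Qiso_sub_le`** `‖cQ̃′ − Q̃′‖ ≤ e^{|κ|Λ} − 1` (`Q̃′ = ScalarAveragedCompression.Qiso`: rows carry `n^d` entries `n^{−d/2}`, columns one —
   Schur product `1`), **`opNorm_conjMat_QisoH_sub_le`**;
 * **`opNorm_conjMat_PiS_sub_le`** `‖cΠ′ − Π′‖ ≤ e^{|κ|Λ} − 1`.
Every constant is free of `n = L^j` and of the torus — the inputs of the conjugation bounds of `G′ = (Δ′)⁻¹`, `∂G′`, `Q̃′G′²Q̃′ᴴ` and of the
projection term `∂·P·∂ᴴ` (files VEC-3 ff.).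

HONEST FRAMING (T4-DAG p. 1).  `U = 1` lattice linear algebra ([folklore]); no estimate of any NE row; nothing printed is a hypothesis or a conclusion;
no `def … : Prop` fact; spine 0/9 unchanged; NOT infinite volume ∕ mass gap ∕ Clay.  HONEST DEPENDENCY: continuum YM on T⁴ ⇐ BetaPertH ∧ nine spine
estimates (0/9 proved); BetaPertH ⇐ (D1) ∧ (D4) ∧ CAP+tail; G-an2-4 gates asym, D1 and NE2/3/4.  ABSOLUTE RULE kept; no `sorry`.
-/

noncomputable section

open scoped BigOperators ComplexConjugate Matrix Matrix.Norms.L2Operator ComplexOrder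

namespace Summit.QuantumFields.BalabanUV.T4Continuum.CTConjugationTorus

open Literature.MathematicalPhysics.QuantumFieldTheory.Balaban1983to89.B5Prop11Plancherel (Tor fine unitVec)
open Literature.MathematicalPhysics.QuantumFieldTheory.Balaban1983to89.B5Action121 (sdiff GradOp)
open Literature.MathematicalPhysics.QuantumFieldTheory.Balaban1983to89.B5Block118 (QsOp bpt)
open Literature.MathematicalPhysics.QuantumFieldTheory.Balaban1983to89.B5Blocks16 (blockOf blockOf_bpt bpt_bijective)
open Literature.MathematicalPhysics.QuantumFieldTheory.Balaban1983to89.B5Prop11Lower (nsq nsq_nonneg)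
open Summit.QuantumFields.BalabanUV.T4Continuum
open Summit.QuantumFields.BalabanUV.T4Continuum.ScalarAveragedCompression (Qiso)
open Summit.QuantumFields.BalabanUV.T4Continuum.ScalarBlockPoincare (PiS QsOp_apply_blockOf)
open Summit.QuantumFields.BalabanUV.T4Continuum.ScalarCovariantCTDefects (PiS_apply sum_ite_blockOf_eq)
open Summit.QuantumFields.BalabanUV.T4Continuum.CTWeightedCoercivity
open Summit.QuantumFields.BalabanUV.T4Continuum.CTConjugationPieces

section Torus

variable {d : ℕ} (n : ℕ) [NeZero n] (M : Fin d → ℕ) [hM : ∀ μ, NeZero (M μ)]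

/-- the bond weight induced by a site weight (a bond carries the weight of its base site). [folklore] -/
abbrev bondW₀ (ρ₀ : Tor (fine n M) → ℝ) : Tor (fine n M) × Fin d → ℝ := fun b => ρ₀ b.1

/-- the coarse weight induced by a site weight (a block carries the weight of its corner `n·y`). [folklore] -/
abbrev coarseW (ρ₀ : Tor (fine n M) → ℝ) : Tor M → ℝ := fun y => ρ₀ (bpt n M y fun _ => 0)

variable {ρ₀ : Tor (fine n M) → ℝ}

/-- the coarse weight is within `Λ` of the site weight on the block. [folklore] -/
theorem abs_coarseW_sub_le {Λ : ℝ} (hosc : ∀ x x', blockOf n M x = blockOf n M x' → |ρ₀ x - ρ₀ x'| ≤ Λ) (y : Tor M) (x : Tor (fine n M))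
    (hx : blockOf n M x = y) : |coarseW n M ρ₀ y - ρ₀ x| ≤ Λ :=
  hosc _ _ (by rw [blockOf_bpt, hx])

omit [NeZero n] hM in
/-- the entries of the gradient `∂`: `∂((x,ν), y) = n·([y = x + e_ν] − [y = x])`. [folklore] -/
theorem GradOp_apply (b : Tor (fine n M) × Fin d) (y : Tor (fine n M)) :
    GradOp (fine n M) ((n : ℕ) : ℂ) b y = ((n : ℕ) : ℂ) * ((if y = b.1 + unitVec (fine n M) b.2 then 1 else 0) - (if b.1 = y then 1 else 0)) := by
  rw [GradOp, GaugeTermDecomposition.sdiff_def, Matrix.smul_apply, smul_eq_mul, Matrix.sub_apply, Matrix.one_apply]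
  rfl

omit [NeZero n] hM in
/-- the absolute entries of `∂` are dominated by `n·([y = x + e_ν] + [x = y])`. [folklore] -/
theorem norm_GradOp_apply_le (b : Tor (fine n M) × Fin d) (y : Tor (fine n M)) :
    ‖GradOp (fine n M) ((n : ℕ) : ℂ) b y‖ ≤ (n : ℝ) * ((if y = b.1 + unitVec (fine n M) b.2 then 1 else 0) + (if b.1 = y then 1 else 0)) := by
  rw [GradOp_apply, norm_mul, Complex.norm_natCast]
  refine mul_le_mul_of_nonneg_left ?_ (Nat.cast_nonneg _)
  refine (norm_sub_le _ _).trans ?_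
  split_ifs <;> simp

/-- **`‖c∂ − ∂‖ ≤ 2√d·|κ|·e^{|κ|}`** for a `1/n`-Lipschitz site weight (bond weight = weight of the base site): the level-free conjugation bound of
the gradient (entries `n` at weight-distance `≤ 1/n`, `n(e^{|κ|/n} − 1) ≤ |κ|e^{|κ|}`). [folklore] -/
theorem opNorm_conjMat_GradOp_sub_le (κ : ℝ) (hlip : ∀ x ν, |ρ₀ (x + unitVec (fine n M) ν) - ρ₀ x| ≤ 1 / n) :
    ‖conjMat κ (bondW₀ n M ρ₀) ρ₀ (GradOp (fine n M) ((n : ℕ) : ℂ)) - GradOp (fine n M) ((n : ℕ) : ℂ)‖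
      ≤ 2 * Real.sqrt d * |κ| * Real.exp |κ| := by
  have hn1 : 1 ≤ n := Nat.one_le_iff_ne_zero.mpr (NeZero.ne n)
  have hn0 : (0 : ℝ) < n := by exact_mod_cast hn1
  -- support: `y = x` (weight difference `0`) or `y = x + e_ν` (difference `≤ 1/n`)
  have hsupp : ∀ (b : Tor (fine n M) × Fin d) (y : Tor (fine n M)), GradOp (fine n M) ((n : ℕ) : ℂ) b y ≠ 0 → |bondW₀ n M ρ₀ b - ρ₀ y| ≤ 1 / n := by
    intro b y hb
    rw [GradOp_apply] at hb
    by_cases h1 : y = b.1 + unitVec (fine n M) b.2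
    · rw [h1, abs_sub_comm]; exact hlip _ _
    · by_cases h2 : b.1 = y
      · simp only [bondW₀, h2, sub_self, abs_zero]; positivity
      · exact absurd (by rw [if_neg h1, if_neg h2, sub_zero, mul_zero]) hb
  have hrow : ∀ b : Tor (fine n M) × Fin d, ∑ y, ‖GradOp (fine n M) ((n : ℕ) : ℂ) b y‖ ≤ 2 * n := by
    intro b
    calc ∑ y, ‖GradOp (fine n M) ((n : ℕ) : ℂ) b y‖
        ≤ ∑ y, (n : ℝ) * ((if y = b.1 + unitVec (fine n M) b.2 then 1 else 0) + (if b.1 = y then 1 else 0)) :=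
          Finset.sum_le_sum fun y _ => norm_GradOp_apply_le n M b y
      _ = (n : ℝ) * (1 + 1) := by
          rw [← Finset.mul_sum, Finset.sum_add_distrib, Finset.sum_ite_eq' Finset.univ (b.1 + unitVec (fine n M) b.2),
            Finset.sum_ite_eq Finset.univ b.1]
          simp
      _ = 2 * n := by ring
  have hcol : ∀ y : Tor (fine n M), ∑ b : Tor (fine n M) × Fin d, ‖GradOp (fine n M) ((n : ℕ) : ℂ) b y‖ ≤ 2 * d * n := by
    intro y
    calc ∑ b : Tor (fine n M) × Fin d, ‖GradOp (fine n M) ((n : ℕ) : ℂ) b y‖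
        ≤ ∑ b : Tor (fine n M) × Fin d, (n : ℝ) * ((if y = b.1 + unitVec (fine n M) b.2 then 1 else 0) + (if b.1 = y then 1 else 0)) :=
          Finset.sum_le_sum fun b _ => norm_GradOp_apply_le n M b y
      _ = (n : ℝ) * ∑ ν : Fin d, ∑ x : Tor (fine n M), ((if y = x + unitVec (fine n M) ν then (1 : ℝ) else 0) + (if x = y then 1 else 0)) := by
          rw [← Finset.mul_sum, Fintype.sum_prod_type, Finset.sum_comm]
      _ = (n : ℝ) * ∑ _ν : Fin d, ((1 : ℝ) + 1) := by
          congr 1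
          refine Finset.sum_congr rfl fun ν _ => ?_
          rw [Finset.sum_add_distrib, Finset.sum_ite_eq' Finset.univ y]
          simp only [Finset.mem_univ, if_true]
          congr 1
          rw [Finset.sum_eq_single (y - unitVec (fine n M) ν)]
          · simp
          · intro x _ hx; rw [if_neg]; intro h; exact hx (by rw [h, add_sub_cancel_right])
          · intro h; exact absurd (Finset.mem_univ _) h
      _ = 2 * d * n := by rw [Finset.sum_const, Finset.card_univ, Fintype.card_fin, nsmul_eq_mul]; ring
  calc ‖conjMat κ (bondW₀ n M ρ₀) ρ₀ (GradOp (fine n M) ((n : ℕ) : ℂ)) - GradOp (fine n M) ((n : ℕ) : ℂ)‖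
      ≤ (Real.exp (|κ| * (1 / n)) - 1) * Real.sqrt ((2 * n) * (2 * d * n)) :=
        opNorm_conjMat_sub_le_schur κ _ _ _ (by positivity) (by positivity) (by positivity) hsupp hrow hcol
    _ = 2 * Real.sqrt d * ((n : ℝ) * (Real.exp (|κ| / n) - 1)) := by
        rw [show (2 * (n : ℝ)) * (2 * d * n) = (d : ℝ) * (2 * n) ^ 2 by ring, Real.sqrt_mul (Nat.cast_nonneg _), Real.sqrt_sq (by positivity),
          show |κ| * (1 / (n : ℝ)) = |κ| / n by ring]
        ring
    _ ≤ 2 * Real.sqrt d * (|κ| * Real.exp |κ|) := mul_le_mul_of_nonneg_left (nat_mul_exp_div_sub_one_le (abs_nonneg κ) hn1) (by positivity)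
    _ = 2 * Real.sqrt d * |κ| * Real.exp |κ| := by ring

/-- **`‖c∂ᴴ − ∂ᴴ‖ ≤ 2√d·|κ|·e^{|κ|}`** (adjoint rule). [folklore] -/
theorem opNorm_conjMat_GradOpH_sub_le (κ : ℝ) (hlip : ∀ x ν, |ρ₀ (x + unitVec (fine n M) ν) - ρ₀ x| ≤ 1 / n) :
    ‖conjMat κ ρ₀ (bondW₀ n M ρ₀) (GradOp (fine n M) ((n : ℕ) : ℂ))ᴴ - (GradOp (fine n M) ((n : ℕ) : ℂ))ᴴ‖
      ≤ 2 * Real.sqrt d * |κ| * Real.exp |κ| := by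
  rw [opNorm_conjMat_conjTranspose_sub_eq]
  have h := opNorm_conjMat_GradOp_sub_le n M (-κ) hlip
  rwa [abs_neg] at h

/-- **`‖cQ̃′ − Q̃′‖ ≤ e^{|κ|Λ} − 1`** for the isometric block averaging `Q̃′ = √(n^d)·Q′` (coarse weight vs site weight, block oscillation `≤ Λ`):
rows carry `n^d` entries `n^{−d/2}`, columns one — the Schur product is `1`, whatever `n`. [folklore] -/
theorem opNorm_conjMat_Qiso_sub_le (κ : ℝ) {Λ : ℝ} (hΛ : 0 ≤ Λ) (hosc : ∀ x x', blockOf n M x = blockOf n M x' → |ρ₀ x - ρ₀ x'| ≤ Λ) :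
    ‖conjMat κ (coarseW n M ρ₀) ρ₀ (Qiso n M) - Qiso n M‖ ≤ Real.exp (|κ| * Λ) - 1 := by
  have hn0 : (0 : ℝ) < (n : ℝ) ^ d := pow_pos (by exact_mod_cast Nat.pos_of_ne_zero (NeZero.ne n)) d
  have hsq : Real.sqrt ((n : ℝ) ^ d) * Real.sqrt ((n : ℝ) ^ d) = (n : ℝ) ^ d := Real.mul_self_sqrt hn0.le
  -- entries: `Q̃′(y, x) = n^{−d/2}·[blockOf x = y]`
  have hentry : ∀ (y : Tor M) (x : Tor (fine n M)), ‖Qiso n M y x‖ = if blockOf n M x = y then (Real.sqrt ((n : ℝ) ^ d))⁻¹ else 0 := by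
    intro y x
    rw [Qiso, Matrix.smul_apply, smul_eq_mul, QsOp_apply_blockOf]
    split_ifs with h
    · rw [norm_mul, Complex.norm_real, Real.norm_of_nonneg (Real.sqrt_nonneg _), norm_div, norm_one, norm_pow, Complex.norm_natCast,
        mul_one_div, Real.sqrt_div_self', one_div]
    · rw [mul_zero, norm_zero]
  have hsupp : ∀ (y : Tor M) (x : Tor (fine n M)), Qiso n M y x ≠ 0 → |coarseW n M ρ₀ y - ρ₀ x| ≤ Λ := by
    intro y x h
    have hb : blockOf n M x = y := by
      by_contra hne
      exact h (by rw [Qiso, Matrix.smul_apply, smul_eq_mul, QsOp_apply_blockOf, if_neg hne, mul_zero])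
    exact abs_coarseW_sub_le n M hosc y x hb
  have hrow : ∀ y : Tor M, ∑ x, ‖Qiso n M y x‖ ≤ Real.sqrt ((n : ℝ) ^ d) := by
    intro y
    simp_rw [hentry]
    rw [sum_ite_blockOf_eq n M y, ← div_eq_mul_inv, Real.div_sqrt]
  have hcol : ∀ x : Tor (fine n M), ∑ y, ‖Qiso n M y x‖ ≤ (Real.sqrt ((n : ℝ) ^ d))⁻¹ := by
    intro x
    simp_rw [hentry]
    rw [Finset.sum_ite_eq Finset.univ (blockOf n M x)]
    simp
  calc ‖conjMat κ (coarseW n M ρ₀) ρ₀ (Qiso n M) - Qiso n M‖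
      ≤ (Real.exp (|κ| * Λ) - 1) * Real.sqrt (Real.sqrt ((n : ℝ) ^ d) * (Real.sqrt ((n : ℝ) ^ d))⁻¹) :=
        opNorm_conjMat_sub_le_schur κ _ _ _ hΛ (Real.sqrt_nonneg _) (by positivity) hsupp hrow hcol
    _ = Real.exp (|κ| * Λ) - 1 := by rw [mul_inv_cancel₀ (Real.sqrt_pos.mpr hn0).ne', Real.sqrt_one, mul_one]

/-- **`‖cQ̃′ᴴ − Q̃′ᴴ‖ ≤ e^{|κ|Λ} − 1`** (adjoint rule). [folklore] -/
theorem opNorm_conjMat_QisoH_sub_le (κ : ℝ) {Λ : ℝ} (hΛ : 0 ≤ Λ) (hosc : ∀ x x', blockOf n M x = blockOf n M x' → |ρ₀ x - ρ₀ x'| ≤ Λ) :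
    ‖conjMat κ ρ₀ (coarseW n M ρ₀) (Qiso n M)ᴴ - (Qiso n M)ᴴ‖ ≤ Real.exp (|κ| * Λ) - 1 := by
  rw [opNorm_conjMat_conjTranspose_sub_eq]
  have h := opNorm_conjMat_Qiso_sub_le n M (-κ) hΛ hosc
  rwa [abs_neg] at h

/-- **`‖cΠ′ − Π′‖ ≤ e^{|κ|Λ} − 1`** for the block-mean projector `Π′` (site weight on both sides, block oscillation `≤ Λ`). [folklore] -/
theorem opNorm_conjMat_PiS_sub_le (κ : ℝ) {Λ : ℝ} (hΛ : 0 ≤ Λ) (hosc : ∀ x x', blockOf n M x = blockOf n M x' → |ρ₀ x - ρ₀ x'| ≤ Λ) :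
    ‖conjMat κ ρ₀ ρ₀ (PiS n M) - PiS n M‖ ≤ Real.exp (|κ| * Λ) - 1 := by
  have hn0 : (0 : ℝ) < (n : ℝ) ^ d := pow_pos (by exact_mod_cast Nat.pos_of_ne_zero (NeZero.ne n)) d
  have hentry : ∀ x x' : Tor (fine n M), ‖PiS n M x x'‖ = if blockOf n M x = blockOf n M x' then ((n : ℝ) ^ d)⁻¹ else 0 := by
    intro x x'
    rw [PiS_apply]
    split_ifs
    · rw [norm_div, norm_one, norm_pow, Complex.norm_natCast, one_div]
    · rw [norm_zero]
  have hsupp : ∀ x x' : Tor (fine n M), PiS n M x x' ≠ 0 → |ρ₀ x - ρ₀ x'| ≤ Λ := by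
    intro x x' h
    by_cases hb : blockOf n M x = blockOf n M x'
    · exact hosc x x' hb
    · exact absurd (by rw [PiS_apply, if_neg hb]) h
  have hrow : ∀ x : Tor (fine n M), ∑ x', ‖PiS n M x x'‖ ≤ 1 := by
    intro x
    simp_rw [hentry]
    have : ∑ x' : Tor (fine n M), (if blockOf n M x = blockOf n M x' then ((n : ℝ) ^ d)⁻¹ else 0)
        = ∑ x' : Tor (fine n M), (if blockOf n M x' = blockOf n M x then ((n : ℝ) ^ d)⁻¹ else 0) :=
      Finset.sum_congr rfl fun x' _ => by simp only [eq_comm]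
    rw [this, sum_ite_blockOf_eq n M (blockOf n M x), mul_inv_cancel₀ hn0.ne']
  have hcol : ∀ x' : Tor (fine n M), ∑ x, ‖PiS n M x x'‖ ≤ 1 := by
    intro x'
    simp_rw [hentry]
    rw [sum_ite_blockOf_eq n M (blockOf n M x'), mul_inv_cancel₀ hn0.ne']
  calc ‖conjMat κ ρ₀ ρ₀ (PiS n M) - PiS n M‖ ≤ (Real.exp (|κ| * Λ) - 1) * Real.sqrt (1 * 1) :=
        opNorm_conjMat_sub_le_schur κ _ _ _ hΛ zero_le_one zero_le_one hsupp hrow hcol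
    _ = Real.exp (|κ| * Λ) - 1 := by rw [mul_one, Real.sqrt_one, mul_one]

end Torus

end Summit.QuantumFields.BalabanUV.T4Continuum.CTConjugationTorus

end
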